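import Summits.BirchSwinnertonDyer.BirchSwinnertonDyer.Theorems.KimAtThreeShallowEqDeepPositionDefs
import Summits.BirchSwinnertonDyer.BirchSwinnertonDyer.Theorems.KimAtThreeDeepLowerKatoLit
import Summits.BirchSwinnertonDyer.BirchSwinnertonDyer.Theorems.KimAtThreeFineKatoPositionUnit
import Summits.BirchSwinnertonDyer.BirchSwinnertonDyer.Theorems.KimAtThreeFineKatoPositionCrux
import Summits.BirchSwinnertonDyer.BirchSwinnertonDyer.Theorems.KimAtThreeShallowEqDeepNonAdditiveOfPosition
import Summits.BirchSwinnertonDyer.BirchSwinnertonDyer.Theorems.KimAtThreeShallowEqDeepRouteLeafOfPosition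
import Literature.NumberTheory.PAdicHodge.DualExpEllipticTowerSelf
import HarnessLib

/-!
# Route `KimAtThreeKolyvagin` (W2): hKatoPosʷ FROM the named statement `KatoPeriodPositionAtThree`, and the cruxes 19560 /
# 19599 / 19077, the support items 20275 / 20397 and the ROUTE LEAF `N11.KimAtThreeRankZeroPUB` BY NAME keyed on it
# (cell `bsd-addord`, seat w2-c4 gen 13; `--supports stmt-BirchSwinnertonDyer-19077`, helper)

HONEST FRAMING.  END-TYPE COMPOSITION THEOREMS (no definition, no named fact, no instance, no `sorry`).  Hypotheses: the named
statement `KatoPeriodPositionAtThree` (`Theorems/KimAtThreeShallowEqDeepPositionDefs.lean`, same seat) — the route's OWN displayed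
hypothesis, STRONGER than Kato's theorem (the Literature fact has no position conjunct; the position is the cell's reading (a″),
print status PRE) —, the cite-only Literature facts (S5a) `expStarCoord_eq_zero_iff_kummer`, (S5b-tower)
`exists_smul_range_expStarCoord_tower_iff_trace_log`, (P123) `cupLogInjective_and_hasDualExp_of_isDeRham`, (DR)
`isDeRham_restrictedRationalTateRep` and, where stated, the Kato fact `Kato2004.exists_eulerSystem_definedExpStar_values`; the route
leaves `SakamotoKolyvaginThree`, `RankEqAnalyticRankLeOne`, `PoitouTateSelmerDuality`, `CarayolLevelEqConductor` (held-PUB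
statements) and the route decl `FineKatoTwoExpDefectThree` (item 20398, additive-defect rows).  ALL CONDITIONAL; nothing is closed or
booked by this file; BSD is NOT proved by any of this («closes rung W2 of BirchSwinnertonDyer» only modulo the displayed hypotheses).

WHAT.
* §1 `katoPosW_of_periodPosition_of_facts : (P123) → (DR) → KatoPeriodPositionAtThree → hKatoPosʷ` (w2-c4 g12's all-rows Kato
  position package, = the section hypothesis of `KimAtThreeShallowEqDeepRouteLeafOfPosition`): proof = w2-c2 g9's
  `KimAtThreeDeepLowerKatoLit.katoExact_of_lit` (the matrix's `d` IS a `LocalNeronLineAt`; (RES)/(DEF) on cocycles give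
  (RES₀)/(DEF₀) on classes; Kato II Prop. 1.2.3 at the factor field from (P123)/(DR)) + w2-acc4 g6's POS bullet (fact currency →
  place currency via kim3's `expStarOmegaPadicAt_smul`, `expStarOmegaAt_eq_expStarCoord`) — both VERBATIM, now elaborating because
  the matrix is the Literature CONSTANT `Kato2004.DefinedExpStarBody` (p550283) and not pasted text (w2-acc4 16:46Z finding).
* §2 BY NAME, keyed on `KatoPeriodPositionAtThree` ∧ the FOUR cites {(S5a), (S5b-tower), (P123), (DR)} ((S5b) by kim3 g17's
  `exists_smul_range_expStarCoord_iff_trace_log_of_tower`): crux 19560 `KatoKuriharaPortThreeShared` (w2-acc4's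
  `katoKuriharaPortThreeShared_of_facts_of_katoPos` at the stratum rows); items 20275 / 20397 and crux 19599 (+ 3 leaves + 20398)
  (w2-c4 g12's `KimAtThreeShallowEqDeepNonAdditiveOfPosition`); crux 19077 (+ 4 leaves + 20398) and the ROUTE LEAF (+ the Kato
  fact) (w2-c4 g12's `KimAtThreeShallowEqDeepRouteLeafOfPosition`).
READING (08-28): the W2 route leaf ⟸ 4 leaves ∧ 4 cite facts ∧ Kato fact ∧ `KatoPeriodPositionAtThree` ∧ item 20398 — every
hypothesis a NAMED one-liner.
References: [Kim2025RefinedTNC] Thm. 1.1/1.2; [Kato2004Asterisque] (8.1.3), 8.12, §9.4, 9.7, 6.6 (1), 13.3; [Kato1993LNM1553] II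
§1.2.4, 1.2.3; [BlochKato1990] §3; [Kim2022StructureSelmer] Thm. 1.9 (6), 3.13; [Sakamoto2024] Thm. 4.4; [MazurRubin2004] 4.4.1,
5.2.12; [Carayol1986].
-/

noncomputable section

-- the cell's Theorems namespace `Summit.BirchSwinnertonDyer.BirchSwinnertonDyer.…` repeats the summit name by design (D-0017)
set_option linter.dupNamespace false

open scoped Classical NumberField TensorProduct ContRepresentation Pointwise
open Field ValuativeRel Function IsDedekindDomain NumberField CongruenceSubgroup WeierstrassCurve
open Literature.NumberTheory.EllipticCurves
open Literature.NumberTheory.GaloisRepresentations Literature.NumberTheory.GaloisRepresentations.DiscreteGaloisModule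
open Literature.NumberTheory.GaloisCohomology Literature.NumberTheory.GaloisRepresentations.PeriodRingData
open Literature.NumberTheory.GaloisRepresentations.IsNonarchimedeanLocalField
open Literature.NumberTheory.PAdicHodge Literature.NumberTheory.EllipticCurves.ModularForms
open Literature.NumberTheory.EllipticCurves.Rank1Residual Literature.NumberTheory.EllipticCurves.Kato2004
open Literature.NumberTheory.EllipticCurves.Kato2004.EulerSystemValues Literature.NumberTheory.AdelicBaseChange
open Literature.NumberTheory.Automorphic Summit.BirchSwinnertonDyer.Rank1Residual.GaloisImage
open Summit.BirchSwinnertonDyer.Rank1Residual.Additive.LocalLog Summit.BirchSwinnertonDyer.BirchSwinnertonDyer.Theorems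
open KimAtThreeFineKatoLevelCompat KimAtThreeFineKatoPerFactorDefined KimAtThreeDeepLowerExpStarOmega KimAtThreeDeepLowerExpStarOmegaPlace
open KimAtThreeDeepLowerExpStarOmegaRes KimAtThreeFineKatoPerFactorPlaces KimAtThreeDeepUpperExpStarFactsTower
open KimAtThreeDeepUpperExpStarFacts KimAtThreeDeepUpperExpStarTowerRange Rat.HeightOneSpectrum
open Summit.BirchSwinnertonDyer.BirchSwinnertonDyer.Theses.KimAtThreeKolyvagin
open Summit.BirchSwinnertonDyer.BirchSwinnertonDyer.Theorems.KimAtThreeShallowEqDeepPositionDefs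
open Summit.BirchSwinnertonDyer.BirchSwinnertonDyer.Theorems.KimAtThreeFineKatoPositionCrux
  (katoKuriharaPortThreeShared_of_facts_of_katoPos)
open Summit.BirchSwinnertonDyer.BirchSwinnertonDyer.Theorems.KimAtThreeShallowEqDeepNonAdditiveOfPosition
  (definedKatoWeightedNonAdditiveThree_of_katoPos_of_facts fineKatoTauAnomalousThree_of_katoPos_of_facts
    shallowEqDeepOffKatoStratum_of_katoPos_of_facts)
open Summit.BirchSwinnertonDyer.BirchSwinnertonDyer.Theorems.KimAtThreeShallowEqDeepRouteLeafOfPosition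
  (shallowEqDeepAtTorsionFree_of_katoPos_of_four_cites kimAtThreeRankZeroPUB_of_katoPos_of_lit_of_four_cites)

namespace Summit.BirchSwinnertonDyer.BirchSwinnertonDyer.Theorems.KimAtThreeShallowEqDeepOfPeriodPosition

/-! ### §1 The bridge: `KatoPeriodPositionAtThree` ⟹ hKatoPosʷ -/

set_option backward.isDefEq.respectTransparency false in
set_option maxHeartbeats 1600000 in
/-- **hKatoPosʷ (all `3`-adic-tower rows; w2-c4 g12's displayed Kato-position package) FROM (P123), (DR) and
`KatoPeriodPositionAtThree`.**  Proof = w2-c2's `KimAtThreeDeepLowerKatoLit.katoExact_of_lit` (the fact's `d` IS a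
`LocalNeronLineAt`; (RES)/(DEF) on cocycles give (RES₀)/(DEF₀) on classes; Kato II Prop. 1.2.3 at the factor field from
(P123)/(DR)) with w2-acc4 g6's POS bullet (fact currency → place currency through kim3's `expStarOmegaPadicAt_smul` and
`expStarOmegaAt_eq_expStarCoord`).  CONDITIONAL (three displayed hypotheses); closes nothing; BSD is not proved by this.
[cite: Kato2004Asterisque, (8.1.3) (p. 180), Prop. 8.12 (p. 186), §9.4 and Thm. 9.7 (pp. 188–189), Thm. 6.6 (1) (p. 163), Ex. 13.3 (pp. 224–225)]
[cite: Kato1993LNM1553, Ch. II Prop. 1.2.3 and §1.2.4] [cite: BlochKato1990, §3 (Def. 3.10, Prop. 3.8)] -/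
theorem katoPosW_of_periodPosition_of_facts (hP : cupLogInjective_and_hasDualExp_of_isDeRham)
    (hDR : isDeRham_restrictedRationalTateRep) (hPos : KatoPeriodPositionAtThree) :
    ∀ (W : WeierstrassCurve ℚ) [W.IsElliptic] [W.IsGloballyMinimal]
        [ContinuousSMul ℤ_[3] (W.tateModule 3)] [Module.Free ℤ_[3] (W.tateModule 3)]
        [Module.Finite ℤ_[3] (W.tateModule 3)],
        (∀ m : ℕ, W.HasSurjectiveModNGaloisRep (3 ^ m : ℕ)) →
        ∀ {N : ℕ} [NeZero N] (P : ModularParametrizationData W N), N = W.conductorNorm ℤ →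
          (∀ z ∈ P.L.lattice, ∃ w ∈ periodLattice P.f, z = P.c * w) →
          haveI : Fact (((3 : ℕ) : 𝓞 ℚ) ∈ ((Rat.HeightOneSpectrum.primesEquiv (R := 𝓞 ℚ)).symm ⟨3, Fact.out⟩).asIdeal) :=
            ⟨(natCast_mem_asIdeal_iff_eq_primesEquiv_symm _ Nat.prime_three).mpr rfl⟩
          letI := valuativeRelPlace ((Rat.HeightOneSpectrum.primesEquiv (R := 𝓞 ℚ)).symm ⟨3, Fact.out⟩)
          letI := topologicalSpacePlace ((Rat.HeightOneSpectrum.primesEquiv (R := 𝓞 ℚ)).symm ⟨3, Fact.out⟩)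
          haveI := isNonarchimedeanLocalField_place ((Rat.HeightOneSpectrum.primesEquiv (R := 𝓞 ℚ)).symm ⟨3, Fact.out⟩)
          haveI := charZero_place ((Rat.HeightOneSpectrum.primesEquiv (R := 𝓞 ℚ)).symm ⟨3, Fact.out⟩)
          letI := padicAlgebraPlace 3 ((Rat.HeightOneSpectrum.primesEquiv (R := 𝓞 ℚ)).symm ⟨3, Fact.out⟩)
          haveI := fact_not_isUnit_place 3 ((Rat.HeightOneSpectrum.primesEquiv (R := 𝓞 ℚ)).symm ⟨3, Fact.out⟩)
          haveI := isAdicComplete_place 3 ((Rat.HeightOneSpectrum.primesEquiv (R := 𝓞 ℚ)).symm ⟨3, Fact.out⟩)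
          ∃ (d : LocalNeronLineAt W 3 ((Rat.HeightOneSpectrum.primesEquiv (R := 𝓞 ℚ)).symm ⟨3, Fact.out⟩)),
          ∃ (ι : (n : ℕ) → (CyclotomicField n ℚ →+* ℂ)) (κK : ℝ)
            (Λ : ∀ (k' : ℕ) (r : Finset (HeightOneSpectrum (𝓞 ℚ))),
              H1 (tateRep W 3) (cycSubgroup 3 k' r) →ₗ[ℤ_[3]]
                ℚ_[3] ⊗[ℚ] CyclotomicField (cycLevel 3 k' r) ℚ),
            κK ≠ 0 ∧
            (∃ u : ℚ, (u : ℝ) = κK ∧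
              ∀ (hinj : (bdRPeriodRingData (valuation_place_lt_one 3 ((Rat.HeightOneSpectrum.primesEquiv (R := 𝓞 ℚ)).symm ⟨3, Fact.out⟩))).CupLogInjective (logCyclotomic 3)
              (localRationalTateRep W 3 (galRestrictPlace ((Rat.HeightOneSpectrum.primesEquiv (R := 𝓞 ℚ)).symm ⟨3, Fact.out⟩))))
              (hex : ∀ z : contOneCocycles (localRationalTateRep W 3 (galRestrictPlace ((Rat.HeightOneSpectrum.primesEquiv (R := 𝓞 ℚ)).symm ⟨3, Fact.out⟩))).toTopRep,
              (bdRPeriodRingData (valuation_place_lt_one 3 ((Rat.HeightOneSpectrum.primesEquiv (R := 𝓞 ℚ)).symm ⟨3, Fact.out⟩))).HasDualExp (logCyclotomic 3)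
              (localRationalTateRep W 3 (galRestrictPlace ((Rat.HeightOneSpectrum.primesEquiv (R := 𝓞 ℚ)).symm ⟨3, Fact.out⟩))) fun σ => z.1 σ)
                (e : ((Rat.HeightOneSpectrum.primesEquiv (R := 𝓞 ℚ)).symm ⟨3, Fact.out⟩).adicCompletion ℚ) (he : e ≠ 0),
                (∀ a : ℚ_[3], (∃ y, (expStarOmegaPadicAt (d.smul e he) hinj hex (((Padic.adicCompletionEquiv (𝓞 ℚ) ⟨3, Fact.out⟩).symm : (((Rat.HeightOneSpectrum.primesEquiv (R := 𝓞 ℚ)).symm ⟨3, Fact.out⟩).adicCompletion ℚ) →+* ℚ_[3]))) y = a) ↔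
                  ∀ Q : (W.baseChange ℚ_[3]).toAffine.Point, ‖a * padicLog (W.baseChange ℚ_[3]) Q‖ ≤ 1) →
                padicValRat 3 u = ((((Padic.adicCompletionEquiv (𝓞 ℚ) ⟨3, Fact.out⟩).symm : (((Rat.HeightOneSpectrum.primesEquiv (R := 𝓞 ℚ)).symm ⟨3, Fact.out⟩).adicCompletion ℚ) →+* ℚ_[3])) e).valuation) ∧
            (∀ (j : ℕ) (r : Finset (HeightOneSpectrum (𝓞 ℚ)))
              (Ψ : ℚ_[3] ⊗[ℚ] CyclotomicField (cycLevel 3 0 r) ℚ ≃ₐ[ℚ]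
                (Π w : ((Rat.HeightOneSpectrum.primesEquiv (R := 𝓞 ℚ)).symm ⟨3, Fact.out⟩).Extension
                  (𝓞 (CyclotomicField (cycLevel 3 0 r) ℚ)), w.1.adicCompletion (CyclotomicField (cycLevel 3 0 r) ℚ)))
              (hΨ : ∀ (s : ℚ_[3]) (x : CyclotomicField (cycLevel 3 0 r) ℚ)
                (w : ((Rat.HeightOneSpectrum.primesEquiv (R := 𝓞 ℚ)).symm ⟨3, Fact.out⟩).Extension
                  (𝓞 (CyclotomicField (cycLevel 3 0 r) ℚ))),
                Ψ (s ⊗ₜ[ℚ] x) w =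
                  algebraMap (CyclotomicField (cycLevel 3 0 r) ℚ) (w.1.adicCompletion (CyclotomicField (cycLevel 3 0 r) ℚ)) x *
                  algebraMap (((Rat.HeightOneSpectrum.primesEquiv (R := 𝓞 ℚ)).symm ⟨3, Fact.out⟩).adicCompletion ℚ)
                    (w.1.adicCompletion (CyclotomicField (cycLevel 3 0 r) ℚ)) ((Padic.adicCompletionEquiv (𝓞 ℚ) ⟨3, Fact.out⟩) s)),
              ∃ (w₀ : ((Rat.HeightOneSpectrum.primesEquiv (R := 𝓞 ℚ)).symm ⟨3, Fact.out⟩).Extension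
                  (𝓞 (CyclotomicField (cycLevel 3 0 r) ℚ)))
                (g : ((Rat.HeightOneSpectrum.primesEquiv (R := 𝓞 ℚ)).symm ⟨3, Fact.out⟩).Extension
                  (𝓞 (CyclotomicField (cycLevel 3 0 r) ℚ)) → absoluteGaloisGroup ℚ)
                (hg : ∀ w : ((Rat.HeightOneSpectrum.primesEquiv (R := 𝓞 ℚ)).symm ⟨3, Fact.out⟩).Extension
                  (𝓞 (CyclotomicField (cycLevel 3 0 r) ℚ)),
                  sigma (cycLevel 3 0 r) (modNCyclotomicCharacter ℚ (cycLevel 3 0 r) (g w)) • w.1 = w₀.1),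
                  letI := LocalField.charZero_adicCompletion w₀.1
                  letI := LocalField.adicCompletionPadicAlgebra w₀.1 3 (three_mem_asIdeal_extension _ w₀)
                  haveI : Fact (¬ IsUnit ((3 : ℕ) : integerC (w₀.1.adicCompletion (CyclotomicField (cycLevel 3 0 r) ℚ)))) :=
                    ⟨not_isUnit_natCast_integerC (LocalField.valuation_adicCompletion_natCast_lt_one w₀.1 3 (three_mem_asIdeal_extension _ w₀))⟩
                  haveI := isAdicComplete_integerC_natCast (LocalField.valuation_adicCompletion_natCast_lt_one w₀.1 3 (three_mem_asIdeal_extension _ w₀))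
                  ∃ (dw : LocalNeronLine W (LocalField.valuation_adicCompletion_natCast_lt_one w₀.1 3 (three_mem_asIdeal_extension _ w₀))
                    ((galRestrictPlace ((Rat.HeightOneSpectrum.primesEquiv (R := 𝓞 ℚ)).symm ⟨3, Fact.out⟩)).comp
                      (absGaloisRestrict (((Rat.HeightOneSpectrum.primesEquiv (R := 𝓞 ℚ)).symm ⟨3, Fact.out⟩).adicCompletion ℚ) (w₀.1.adicCompletion (CyclotomicField (cycLevel 3 0 r) ℚ)))))
                    (hinjw : (bdRPeriodRingData (LocalField.valuation_adicCompletion_natCast_lt_one w₀.1 3 (three_mem_asIdeal_extension _ w₀))).CupLogInjective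
                    (logCyclotomic 3) (localRationalTateRep W 3 ((galRestrictPlace ((Rat.HeightOneSpectrum.primesEquiv (R := 𝓞 ℚ)).symm ⟨3, Fact.out⟩)).comp
                      (absGaloisRestrict (((Rat.HeightOneSpectrum.primesEquiv (R := 𝓞 ℚ)).symm ⟨3, Fact.out⟩).adicCompletion ℚ) (w₀.1.adicCompletion (CyclotomicField (cycLevel 3 0 r) ℚ))))))
                    (hexw : ∀ z : contOneCocycles (localRationalTateRep W 3 ((galRestrictPlace ((Rat.HeightOneSpectrum.primesEquiv (R := 𝓞 ℚ)).symm ⟨3, Fact.out⟩)).comp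
                      (absGaloisRestrict (((Rat.HeightOneSpectrum.primesEquiv (R := 𝓞 ℚ)).symm ⟨3, Fact.out⟩).adicCompletion ℚ) (w₀.1.adicCompletion (CyclotomicField (cycLevel 3 0 r) ℚ))))).toTopRep,
                    (bdRPeriodRingData (LocalField.valuation_adicCompletion_natCast_lt_one w₀.1 3 (three_mem_asIdeal_extension _ w₀))).HasDualExp
                      (logCyclotomic 3) (localRationalTateRep W 3 ((galRestrictPlace ((Rat.HeightOneSpectrum.primesEquiv (R := 𝓞 ℚ)).symm ⟨3, Fact.out⟩)).comp
                      (absGaloisRestrict (((Rat.HeightOneSpectrum.primesEquiv (R := 𝓞 ℚ)).symm ⟨3, Fact.out⟩).adicCompletion ℚ) (w₀.1.adicCompletion (CyclotomicField (cycLevel 3 0 r) ℚ))))) fun σ => z.1 σ),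
                    (∀ (h : (tateLocalRep W 3 (Sum.inr ((Rat.HeightOneSpectrum.primesEquiv (R := 𝓞 ℚ)).symm ⟨3, Fact.out⟩))).cohomology 1),
                    (expStarOmegaHom (LocalField.valuation_adicCompletion_natCast_lt_one w₀.1 3 (three_mem_asIdeal_extension _ w₀))
                      ((galRestrictPlace ((Rat.HeightOneSpectrum.primesEquiv (R := 𝓞 ℚ)).symm ⟨3, Fact.out⟩)).comp
                      (absGaloisRestrict (((Rat.HeightOneSpectrum.primesEquiv (R := 𝓞 ℚ)).symm ⟨3, Fact.out⟩).adicCompletion ℚ) (w₀.1.adicCompletion (CyclotomicField (cycLevel 3 0 r) ℚ)))) dw hinjw hexw)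
                      (ContinuousRep.cohomologyRes (tateLocalRep W 3 (Sum.inr ((Rat.HeightOneSpectrum.primesEquiv (R := 𝓞 ℚ)).symm ⟨3, Fact.out⟩)))
                        (absGaloisRestrict (((Rat.HeightOneSpectrum.primesEquiv (R := 𝓞 ℚ)).symm ⟨3, Fact.out⟩).adicCompletion ℚ) (w₀.1.adicCompletion (CyclotomicField (cycLevel 3 0 r) ℚ))) 1 h) =
                    algebraMap (((Rat.HeightOneSpectrum.primesEquiv (R := 𝓞 ℚ)).symm ⟨3, Fact.out⟩).adicCompletion ℚ) (w₀.1.adicCompletion (CyclotomicField (cycLevel 3 0 r) ℚ)) (expStarOmegaAt d h)) ∧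
                    (∀ (w : ((Rat.HeightOneSpectrum.primesEquiv (R := 𝓞 ℚ)).symm ⟨3, Fact.out⟩).Extension
                      (𝓞 (CyclotomicField (cycLevel 3 0 r) ℚ)))
                    (y : H1 (tateRep W 3) (cycSubgroup 3 0 r))
                    (φ'' : contOneCocycles (subgroupRep (tateRep W 3).toTopRep (cycSubgroup 3 0 r)))
                    (ψT : contOneCocycles ((tateLocalRep W 3 (Sum.inr ((Rat.HeightOneSpectrum.primesEquiv (R := 𝓞 ℚ)).symm ⟨3, Fact.out⟩))).restrict
                      (absGaloisRestrict (((Rat.HeightOneSpectrum.primesEquiv (R := 𝓞 ℚ)).symm ⟨3, Fact.out⟩).adicCompletion ℚ) (w₀.1.adicCompletion (CyclotomicField (cycLevel 3 0 r) ℚ)))).toTopRep),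
                    oneCocycleClass _ φ'' = conjMap (tateRep W 3).toTopRep (cycSubgroup 3 0 r) (g w) 1 y →
                    (∀ σ, ψT.1 σ = φ''.1 ⟨absGaloisRestrictTower ℚ (((Rat.HeightOneSpectrum.primesEquiv (R := 𝓞 ℚ)).symm ⟨3, Fact.out⟩).adicCompletion ℚ) (w₀.1.adicCompletion (CyclotomicField (cycLevel 3 0 r) ℚ)) σ,
                      absGaloisRestrictTower_adicCompletion_mem_cycSubgroup r w₀ σ⟩) →
                    Ψ (Λ 0 r y) w = galAdicCompletionMap
                      (sigma (cycLevel 3 0 r) (modNCyclotomicCharacter ℚ (cycLevel 3 0 r) (g w)))⁻¹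
                      (inv_smul_eq_of_smul_eq (hg w))
                      ((expStarOmegaHom (LocalField.valuation_adicCompletion_natCast_lt_one w₀.1 3 (three_mem_asIdeal_extension _ w₀))
                      ((galRestrictPlace ((Rat.HeightOneSpectrum.primesEquiv (R := 𝓞 ℚ)).symm ⟨3, Fact.out⟩)).comp
                      (absGaloisRestrict (((Rat.HeightOneSpectrum.primesEquiv (R := 𝓞 ℚ)).symm ⟨3, Fact.out⟩).adicCompletion ℚ) (w₀.1.adicCompletion (CyclotomicField (cycLevel 3 0 r) ℚ)))) dw hinjw hexw) (oneCocycleClass _ ψT)))) ∧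
            ∀ (c d a : ℤ) (A : ℕ), 0 < A → Int.gcd c (6 * 3 * A) = 1 → Int.gcd d (6 * 3 * N) = 1 →
              ∃ (z : ∀ (k' : ℕ) (r : (cyclotomicLevelsRat 3 (badPlaces c d A N)).Ideals),
                    H1 (tateRep W 3) ((cyclotomicLevelsRat 3 (badPlaces c d A N)).level k' r.1))
                (x : ∀ (k' : ℕ) (r : (cyclotomicLevelsRat 3 (badPlaces c d A N)).Ideals),
                    CyclotomicField (cycLevel 3 k' r.1) ℚ),
                ZetaBody W 3 P.f ι κK Λ c d a A z x := by
  intro W _ _ _ _ _ htow N _ P hN hlat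
  haveI : Fact (((3 : ℕ) : 𝓞 ℚ) ∈ ((Rat.HeightOneSpectrum.primesEquiv (R := 𝓞 ℚ)).symm ⟨3, Fact.out⟩).asIdeal) :=
    ⟨(natCast_mem_asIdeal_iff_eq_primesEquiv_symm _ Nat.prime_three).mpr rfl⟩
  letI := valuativeRelPlace ((Rat.HeightOneSpectrum.primesEquiv (R := 𝓞 ℚ)).symm ⟨3, Fact.out⟩)
  letI := topologicalSpacePlace ((Rat.HeightOneSpectrum.primesEquiv (R := 𝓞 ℚ)).symm ⟨3, Fact.out⟩)
  haveI := isNonarchimedeanLocalField_place ((Rat.HeightOneSpectrum.primesEquiv (R := 𝓞 ℚ)).symm ⟨3, Fact.out⟩)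
  haveI := charZero_place ((Rat.HeightOneSpectrum.primesEquiv (R := 𝓞 ℚ)).symm ⟨3, Fact.out⟩)
  letI := padicAlgebraPlace 3 ((Rat.HeightOneSpectrum.primesEquiv (R := 𝓞 ℚ)).symm ⟨3, Fact.out⟩)
  haveI := fact_not_isUnit_place 3 ((Rat.HeightOneSpectrum.primesEquiv (R := 𝓞 ℚ)).symm ⟨3, Fact.out⟩)
  haveI := isAdicComplete_place 3 ((Rat.HeightOneSpectrum.primesEquiv (R := 𝓞 ℚ)).symm ⟨3, Fact.out⟩)
  obtain ⟨d, ι, κK, Λ, hκ0, hpos, hkat, hz⟩ := hPos W htow P hN hlat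
  refine ⟨d, ι, κK, Λ, hκ0, ?_, fun j r Ψ hΨ => ?_, hz⟩
  · -- POS: the fact-currency clause (cocycles, `expStarCoord` of `d`, target `ι₃ e * a`) gives the place-currency one
    -- (classes, `expStarOmegaPadicAt (e • d)`); only `expStarCoord W _ d η₀` crosses the two spellings (w2-acc4 g6).
    obtain ⟨u, hu, hposF⟩ := hpos
    refine ⟨u, hu, fun hinj hex e he hdual₀ => hposF e he fun a => ?_⟩
    rw [← hdual₀ a]
    have hsm := KimAtThreeFineKatoPositionUnit.expStarOmegaPadicAt_smul W ((Rat.HeightOneSpectrum.primesEquiv (R := 𝓞 ℚ)).symm ⟨3, Fact.out⟩)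
      (((Padic.adicCompletionEquiv (𝓞 ℚ) ⟨3, Fact.out⟩).symm : (((Rat.HeightOneSpectrum.primesEquiv (R := 𝓞 ℚ)).symm ⟨3, Fact.out⟩).adicCompletion ℚ) →+* ℚ_[3])) d hinj hex e he
    constructor
    · rintro ⟨η₀, hη⟩
      refine ⟨oneCocycleClass _ η₀, ?_⟩
      rw [hsm, expStarOmegaPadicAt_apply, expStarOmegaAt_eq_expStarCoord, inv_mul_eq_iff_eq_mul₀]
      · exact hη
      · exact (map_ne_zero_iff _ (RingHom.injective _)).mpr he
    · rintro ⟨y, hy⟩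
      obtain ⟨η₀, rfl⟩ := oneCocycleClass_surjective _ y
      refine ⟨η₀, ?_⟩
      rw [hsm, expStarOmegaPadicAt_apply, expStarOmegaAt_eq_expStarCoord, inv_mul_eq_iff_eq_mul₀] at hy
      · exact hy
      · exact (map_ne_zero_iff _ (RingHom.injective _)).mpr he
  obtain ⟨w₀, g, hg, hblk⟩ := hkat 0 r Ψ hΨ
  letI := LocalField.charZero_adicCompletion w₀.1
  letI := LocalField.adicCompletionPadicAlgebra w₀.1 3 (three_mem_asIdeal_extension _ w₀)
  haveI : Fact (¬ IsUnit ((3 : ℕ) : integerC (w₀.1.adicCompletion (CyclotomicField (cycLevel 3 0 r) ℚ)))) :=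
    ⟨not_isUnit_natCast_integerC (LocalField.valuation_adicCompletion_natCast_lt_one w₀.1 3 (three_mem_asIdeal_extension _ w₀))⟩
  haveI := isAdicComplete_integerC_natCast (LocalField.valuation_adicCompletion_natCast_lt_one w₀.1 3 (three_mem_asIdeal_extension _ w₀))
  -- `Place.Completion (Sum.inr v₀)` is `v₀.adicCompletion ℚ` by `rfl`: read the packet's algebra structure on it
  letI instEF : Algebra (NumberField.Place.Completion (K := ℚ) (Sum.inr ((Rat.HeightOneSpectrum.primesEquiv (R := 𝓞 ℚ)).symm ⟨3, Fact.out⟩))) (w₀.1.adicCompletion (CyclotomicField (cycLevel 3 0 r) ℚ)) :=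
    inferInstanceAs (Algebra (((Rat.HeightOneSpectrum.primesEquiv (R := 𝓞 ℚ)).symm ⟨3, Fact.out⟩).adicCompletion ℚ) (w₀.1.adicCompletion (CyclotomicField (cycLevel 3 0 r) ℚ)))
  have hcont : Continuous (algebraMap (NumberField.Place.Completion (K := ℚ) (Sum.inr ((Rat.HeightOneSpectrum.primesEquiv (R := 𝓞 ℚ)).symm ⟨3, Fact.out⟩))) (w₀.1.adicCompletion (CyclotomicField (cycLevel 3 0 r) ℚ))) :=
    continuous_algebraMap (((Rat.HeightOneSpectrum.primesEquiv (R := 𝓞 ℚ)).symm ⟨3, Fact.out⟩).adicCompletion ℚ) (w₀.1.adicCompletion (CyclotomicField (cycLevel 3 0 r) ℚ))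
  -- the fact's line datum at `w₀`, its structure proofs instantiated with the packet's own terms
  obtain ⟨dw, hres, hdef⟩ := hblk (three_mem_asIdeal_extension _ w₀) (LocalField.valuation_adicCompletion_natCast_lt_one w₀.1 3 (three_mem_asIdeal_extension _ w₀))
  -- Kato's Prop. 1.2.3 at the factor field (cite facts), instantiated at the packet's tower representation
  haveI : Module.Finite ℚ_[3] (W.rationalTateModule 3) :=
    WeierstrassCurve.module_finite_rationalTateModule_holds W 3
  have hDRw : GaloisRep.IsDeRham (bdRPeriodRingData (F := (w₀.1.adicCompletion (CyclotomicField (cycLevel 3 0 r) ℚ))) (p := 3) (LocalField.valuation_adicCompletion_natCast_lt_one w₀.1 3 (three_mem_asIdeal_extension _ w₀)))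
      (localRationalTateRep W 3 ((galRestrictPlace ((Rat.HeightOneSpectrum.primesEquiv (R := 𝓞 ℚ)).symm ⟨3, Fact.out⟩)).comp
        (absGaloisRestrict (((Rat.HeightOneSpectrum.primesEquiv (R := 𝓞 ℚ)).symm ⟨3, Fact.out⟩).adicCompletion ℚ) (w₀.1.adicCompletion (CyclotomicField (cycLevel 3 0 r) ℚ))))) :=
    isDeRham_localRationalTateRep_comp_of_facts W 3 ((Rat.HeightOneSpectrum.primesEquiv (R := 𝓞 ℚ)).symm ⟨3, Fact.out⟩) (LocalField.valuation_adicCompletion_natCast_lt_one w₀.1 3 (three_mem_asIdeal_extension _ w₀)) hDR hcont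
  obtain ⟨hinjw, hexw⟩ := hP (LocalField.valuation_adicCompletion_natCast_lt_one w₀.1 3 (three_mem_asIdeal_extension _ w₀)) (localRationalTateRep W 3 ((galRestrictPlace ((Rat.HeightOneSpectrum.primesEquiv (R := 𝓞 ℚ)).symm ⟨3, Fact.out⟩)).comp
    (absGaloisRestrict (((Rat.HeightOneSpectrum.primesEquiv (R := 𝓞 ℚ)).symm ⟨3, Fact.out⟩).adicCompletion ℚ) (w₀.1.adicCompletion (CyclotomicField (cycLevel 3 0 r) ℚ))))) hDRw
  refine ⟨w₀, g, hg, dw, hinjw, hexw, fun h => ?_, fun w y φ'' ψT hφ hψ => ?_⟩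
  · -- (RES₀) on classes from the fact's cocycle-level (RES)
    obtain ⟨η₀, rfl⟩ := oneCocycleClass_surjective _ h
    let ηp := contOneCocycles.pullback (absGaloisRestrict (((Rat.HeightOneSpectrum.primesEquiv (R := 𝓞 ℚ)).symm ⟨3, Fact.out⟩).adicCompletion ℚ) (w₀.1.adicCompletion (CyclotomicField (cycLevel 3 0 r) ℚ)))
      (Y := ((tateLocalRep W 3 (Sum.inr ((Rat.HeightOneSpectrum.primesEquiv (R := 𝓞 ℚ)).symm ⟨3, Fact.out⟩))).restrict (absGaloisRestrict (((Rat.HeightOneSpectrum.primesEquiv (R := 𝓞 ℚ)).symm ⟨3, Fact.out⟩).adicCompletion ℚ) (w₀.1.adicCompletion (CyclotomicField (cycLevel 3 0 r) ℚ)))).toTopRep)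
      (TopRep.ofHom ⟨ContinuousLinearMap.id ℤ (W.tateModule 3), fun _ => rfl⟩) η₀
    let η' : contOneCocycles (localTateRep W 3 ((galRestrictPlace ((Rat.HeightOneSpectrum.primesEquiv (R := 𝓞 ℚ)).symm ⟨3, Fact.out⟩)).comp
        (absGaloisRestrict (((Rat.HeightOneSpectrum.primesEquiv (R := 𝓞 ℚ)).symm ⟨3, Fact.out⟩).adicCompletion ℚ) (w₀.1.adicCompletion (CyclotomicField (cycLevel 3 0 r) ℚ))))).toTopRep := ηp
    have hcl : (tateLocalRep W 3 (Sum.inr ((Rat.HeightOneSpectrum.primesEquiv (R := 𝓞 ℚ)).symm ⟨3, Fact.out⟩))).cohomologyRes (absGaloisRestrict (((Rat.HeightOneSpectrum.primesEquiv (R := 𝓞 ℚ)).symm ⟨3, Fact.out⟩).adicCompletion ℚ) (w₀.1.adicCompletion (CyclotomicField (cycLevel 3 0 r) ℚ))) 1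
        (oneCocycleClass _ η₀) =
        oneCocycleClass (localTateRep W 3 ((galRestrictPlace ((Rat.HeightOneSpectrum.primesEquiv (R := 𝓞 ℚ)).symm ⟨3, Fact.out⟩)).comp
          (absGaloisRestrict (((Rat.HeightOneSpectrum.primesEquiv (R := 𝓞 ℚ)).symm ⟨3, Fact.out⟩).adicCompletion ℚ) (w₀.1.adicCompletion (CyclotomicField (cycLevel 3 0 r) ℚ))))).toTopRep η' :=
      KimAtThreeDeepLowerExpStarOmegaRes.cohomologyRes_oneCocycleClass _ _ η₀
    rw [hcl, expStarOmegaHom_apply, expStarOmega_oneCocycleClass, expStarOmegaAt_eq_expStarCoord]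
    exact hres η₀ ηp fun σ => pullback_id_apply _ _ η₀ σ
  · -- (DEF₀) verbatim on classes of tower cocycles
    rw [expStarOmegaHom_apply, expStarOmega_oneCocycleClass]
    exact hdef w y φ'' ψT hφ hψ

/-! ### §2 The cruxes, support items and the route leaf BY NAME, keyed on `KatoPeriodPositionAtThree` -/

/-- **Crux 19560 `KatoKuriharaPortThreeShared` BY NAME ⟸ (S5a) ∧ (S5b-tower) ∧ (P123) ∧ (DR) ∧ `KatoPeriodPositionAtThree`**
(w2-acc4's `katoKuriharaPortThreeShared_of_facts_of_katoPos` at §1 restricted to the Kato stratum; (S5b) by kim3 g17's theorem).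
CONDITIONAL; nothing booked; 19560 stays OPEN.
[cite: Kato2004Asterisque, §9.4 (p. 188), Thm. 9.7 (p. 189), Ex. 13.3 (pp. 224–225)] [cite: BlochKato1990, §3 Prop. 3.8, Ex. 3.11]
[cite: Kim2022StructureSelmer, Lemma 3.4, Cor. 3.5, Thm. 3.13] -/
theorem katoKuriharaPortThreeShared_of_periodPosition_of_cites (hPos : KatoPeriodPositionAtThree)
    (hP : cupLogInjective_and_hasDualExp_of_isDeRham) (hDR : isDeRham_restrictedRationalTateRep)
    (hS : expStarCoord_eq_zero_iff_kummer) (hT₂ : exists_smul_range_expStarCoord_tower_iff_trace_log) :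
    KatoKuriharaPortThreeShared :=
  katoKuriharaPortThreeShared_of_facts_of_katoPos hS hT₂ hP hDR
    (exists_smul_range_expStarCoord_iff_trace_log_of_tower hT₂)
    (by
      intro W _ _ _ _ _ htow _ _ _ N _ P hN hlat _
      exact katoPosW_of_periodPosition_of_facts hP hDR hPos W htow P hN hlat)

/-- **Item 20275 `DefinedKatoWeightedNonAdditiveThree` BY NAME ⟸ the four cites ∧ `KatoPeriodPositionAtThree`** (w2-c4 g12's
`definedKatoWeightedNonAdditiveThree_of_katoPos_of_facts` at §1).  CONDITIONAL; nothing booked.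
[cite: Kato2004Asterisque, (8.1.3) (p. 180), §9.4 (p. 188), Thm. 9.7 (p. 189), Thm. 16.6.2, Ex. 13.3 (pp. 224–225)]
[cite: BlochKato1990, §3 Prop. 3.8, Ex. 3.11] -/
theorem definedKatoWeightedNonAdditiveThree_of_periodPosition_of_cites (hPos : KatoPeriodPositionAtThree)
    (hP : cupLogInjective_and_hasDualExp_of_isDeRham) (hDR : isDeRham_restrictedRationalTateRep)
    (hS : expStarCoord_eq_zero_iff_kummer) (hT₂ : exists_smul_range_expStarCoord_tower_iff_trace_log) :
    DefinedKatoWeightedNonAdditiveThree :=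
  definedKatoWeightedNonAdditiveThree_of_katoPos_of_facts (katoPosW_of_periodPosition_of_facts hP hDR hPos) hP hDR
    (exists_smul_range_expStarCoord_iff_trace_log_of_tower hT₂) hS hT₂

/-- **Item 20397 `FineKatoTauAnomalousThree` BY NAME ⟸ the four cites ∧ `KatoPeriodPositionAtThree`** (w2-c4 g12's
`fineKatoTauAnomalousThree_of_katoPos_of_facts` at §1).  CONDITIONAL; nothing booked.
[cite: Kato2004Asterisque, (8.1.3) (p. 180), §9.4 (p. 188), Thm. 9.7 (p. 189), Ex. 13.3 (pp. 224–225)]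
[cite: BlochKato1990, §3 Prop. 3.8, Ex. 3.11] [cite: Kim2022StructureSelmer, Lemma 3.4, Cor. 3.5, Thm. 3.13] -/
theorem fineKatoTauAnomalousThree_of_periodPosition_of_cites (hPos : KatoPeriodPositionAtThree)
    (hP : cupLogInjective_and_hasDualExp_of_isDeRham) (hDR : isDeRham_restrictedRationalTateRep)
    (hS : expStarCoord_eq_zero_iff_kummer) (hT₂ : exists_smul_range_expStarCoord_tower_iff_trace_log) :
    FineKatoTauAnomalousThree :=
  fineKatoTauAnomalousThree_of_katoPos_of_facts (katoPosW_of_periodPosition_of_facts hP hDR hPos) hP hDR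
    (exists_smul_range_expStarCoord_iff_trace_log_of_tower hT₂) hS hT₂

/-- **Crux 19599 `ShallowEqDeepOffKatoStratum` BY NAME ⟸ three route leaves ∧ the four cites ∧ `KatoPeriodPositionAtThree` ∧ item
20398** (w2-c4 g12's `shallowEqDeepOffKatoStratum_of_katoPos_of_facts` at §1).  CONDITIONAL; nothing booked; 19599 stays OPEN.
[cite: Kim2025RefinedTNC, Thm 1.2] [cite: Sakamoto2024, Thm. 4.4 (p. 926)] [cite: MazurRubin2004, Thm. 4.4.1 and Thm. 5.2.12]
[cite: Kato2004Asterisque, §9.4 (p. 188), Thm. 9.7 (p. 189), Ex. 13.3 (pp. 224–225)] [cite: BlochKato1990, §3 Prop. 3.8, Ex. 3.11] -/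
theorem shallowEqDeepOffKatoStratum_of_periodPosition_of_cites (hPos : KatoPeriodPositionAtThree)
    (hSak : SakamotoKolyvaginThree) (hGZK : RankEqAnalyticRankLeOne) (hPT : PoitouTateSelmerDuality)
    (hP : cupLogInjective_and_hasDualExp_of_isDeRham) (hDR : isDeRham_restrictedRationalTateRep)
    (hS : expStarCoord_eq_zero_iff_kummer) (hT₂ : exists_smul_range_expStarCoord_tower_iff_trace_log)
    (h₃ : FineKatoTwoExpDefectThree) : ShallowEqDeepOffKatoStratum :=
  shallowEqDeepOffKatoStratum_of_katoPos_of_facts (katoPosW_of_periodPosition_of_facts hP hDR hPos) hSak hGZK hPT hP hDR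
    (exists_smul_range_expStarCoord_iff_trace_log_of_tower hT₂) hS hT₂ h₃

/-- **Crux 19077 `ShallowEqDeepAtTorsionFree` BY NAME ⟸ the four route leaves ∧ the four cites {(S5a), (S5b-tower), (P123), (DR)} ∧
`KatoPeriodPositionAtThree` ∧ item 20398** — every hypothesis a named one-liner (w2-c4 g12's
`shallowEqDeepAtTorsionFree_of_katoPos_of_four_cites` at §1; 19560 discharged inside).  CONDITIONAL; nothing booked; 19077 stays OPEN.
[cite: Kim2025RefinedTNC, Thm 1.2] [cite: Sakamoto2024, Thm. 4.4 (p. 926)] [cite: MazurRubin2004, Thm. 4.4.1 and Thm. 5.2.12]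
[cite: Kato2004Asterisque, (8.1.3) (p. 180), Prop. 8.12 (p. 186), §9.4 and Thm. 9.7 (pp. 188–189), Thm. 6.6 (1) (p. 163), Ex. 13.3 (pp. 224–225)]
[cite: Kato1993LNM1553, Ch. II §1.2.4, Prop. 1.2.3 and Thm. 1.4.1] [cite: BlochKato1990, §3 Prop. 3.8, Ex. 3.11] [cite: Carayol1986] -/
theorem shallowEqDeepAtTorsionFree_of_periodPosition_of_cites (hPos : KatoPeriodPositionAtThree)
    (hSak : SakamotoKolyvaginThree) (hGZK : RankEqAnalyticRankLeOne) (hPT : PoitouTateSelmerDuality)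
    (hlev : CarayolLevelEqConductor)
    (hP : cupLogInjective_and_hasDualExp_of_isDeRham) (hDR : isDeRham_restrictedRationalTateRep)
    (hS : expStarCoord_eq_zero_iff_kummer) (hT₂ : exists_smul_range_expStarCoord_tower_iff_trace_log)
    (h₃ : FineKatoTwoExpDefectThree) : ShallowEqDeepAtTorsionFree :=
  shallowEqDeepAtTorsionFree_of_katoPos_of_four_cites (katoPosW_of_periodPosition_of_facts hP hDR hPos)
    hSak hGZK hPT hlev hP hDR hS hT₂ h₃

/-- **The ROUTE LEAF `N11.KimAtThreeRankZeroPUB` BY NAME ⟸ the four route leaves ∧ the four cites ∧ the Kato Literature fact ∧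
`KatoPeriodPositionAtThree` ∧ item 20398** (w2-c4 g12's `kimAtThreeRankZeroPUB_of_katoPos_of_lit_of_four_cites` at §1: the route's
`closes` on w2-c2 / w2-c3's cite-only deep cruxes, the 19077 theorem above and kim3's assembly).  CONDITIONAL on every displayed
hypothesis; closes the rung-W2 leaf only modulo them; BSD is NOT proved by this.
[cite: Kim2025RefinedTNC, Thm 1.1, Thm 1.2] [cite: Kato2004Asterisque, (8.1.3) (p. 180), Prop. 8.12 (p. 186), §9.4 and Thm. 9.7 (pp. 188–189), Thm. 6.6 (1) (p. 163), Ex. 13.3 (pp. 224–225)]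
[cite: Kato1993LNM1553, Ch. II §1.2.4, Prop. 1.2.3 and Thm. 1.4.1] [cite: BlochKato1990, §3 Prop. 3.8, Ex. 3.11]
[cite: Sakamoto2024, Thm. 4.4 (p. 926)] [cite: MazurRubin2004, Thm. 4.4.1 and Thm. 5.2.12] [cite: Carayol1986] -/
theorem kimAtThreeRankZeroPUB_of_periodPosition_of_lit_of_cites (hPos : KatoPeriodPositionAtThree)
    (hLit : Kato2004.exists_eulerSystem_definedExpStar_values)
    (hSak : SakamotoKolyvaginThree) (hGZK : RankEqAnalyticRankLeOne) (hPT : PoitouTateSelmerDuality)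
    (hlev : CarayolLevelEqConductor)
    (hP : cupLogInjective_and_hasDualExp_of_isDeRham) (hDR : isDeRham_restrictedRationalTateRep)
    (hS : expStarCoord_eq_zero_iff_kummer) (hT₂ : exists_smul_range_expStarCoord_tower_iff_trace_log)
    (h₃ : FineKatoTwoExpDefectThree) :
    Summit.BirchSwinnertonDyer.Rank1Residual.Additive.N11.KimAtThreeRankZeroPUB :=
  kimAtThreeRankZeroPUB_of_katoPos_of_lit_of_four_cites (katoPosW_of_periodPosition_of_facts hP hDR hPos)
    hLit hSak hGZK hPT hlev hP hDR hS hT₂ h₃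

end Summit.BirchSwinnertonDyer.BirchSwinnertonDyer.Theorems.KimAtThreeShallowEqDeepOfPeriodPosition

end
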